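import Literature.NumberTheory.Automorphic.IdeleClassCharacterAlgebraicTwist
import HarnessLib

/-!
# Local values of a conjugate self-dual character and of its conjugate: `μᶜ_w = μ_w⁻¹`, `μ^{alg}(ϖ_{cw}) μ^{alg}(ϖ_w) = q_w`

Topic `NumberTheory/Automorphic`; namespace `Literature.NumberTheory.Automorphic.IdeleClassGroup`. KERNEL ONLY:
theorems; no definition, no named fact, no `sorry`. Sequel of `IdeleClassCharacterConjugate` (`galConj`,
`isConjugateSelfDual_iff_galConj_eq_inv`) and `IdeleClassCharacterAlgebraicTwist` (`muAlg`).

For a CM field `L` with complex conjugation `c` and a continuous unitary idele class character `μ : C_L →ₜ* S¹`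
that is CONJUGATE SELF-DUAL ([Liu2021] Def. 4.1: `μ` trivial on `N_{𝔸_L/𝔸_{L⁺}} 𝔸_L^×`, equivalently
`μᶜ = μ⁻¹`; e.g. conjugate symplectic, [Liu2021] Remark 4.2):

* §1 `toHeckeCharacter_galConj_complexConj` — as Hecke characters **`μᶜ = μ⁻¹`**; hence the LOCAL COMPONENTS
  `(μᶜ)_w = (μ_w)⁻¹` at EVERY finite place `w` (`localComponent_toHeckeCharacter_galConj_complexConj`) and the values
  at uniformisers `μᶜ(ϖ_w) = μ(ϖ_w)⁻¹` (no unramifiedness needed).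
* §2 at a place where `μ` is unramified at `c • w`: **`μ(ϖ_{c•w}) = μ(ϖ_w)⁻¹`**
  (`valueAtUniformizer_toHeckeCharacter_complexConj_smul`, via the tree's `valueAtUniformizer_galConj_of_isUnramifiedAt`).
* §3 Liu's algebraic twist `μ^{alg} = μ |·|^{-1/2}` ([Liu2021] §4.1): **`μ^{alg}(ϖ_{c•w}) · μ^{alg}(ϖ_w) = q_w`**
  (`q_w = N w = N (c • w)`), i.e. `μ^{alg}(ϖ_{c•w}) = q_w / μ^{alg}(ϖ_w)`, and `(μ^{alg})ᶜ(ϖ_w) = μ^{alg}(ϖ_{c•w})`.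

Written for the d6 line of the cell `hodgecm-mathlib` (card S4, the `ν`-slot of the split-place Satake pair: by
`GelbartRogawski1991/LocalUnitaryUndoublingSplitMixedModel` the first Levi character of the local Weil representation of
THE `θ`-splitting at a split place `w₀` is `ν = θ_{w₀}`, `θ = μᶜ`; this file reads it as `ν = μ_{w₀}⁻¹`); nothing here
is a claim of [Liu2021].

## References

* Y. Liu, Camb. J. Math. 9 (2021), §4.1: Def. 4.1, Remark 4.2, Remark 4.4, display after Def. 4.3 [Liu2021].
* J. Tate, *Fourier analysis in number fields* (1950/1967), §4.3 [TateThesis1967].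
-/

set_option autoImplicit false

noncomputable section

open NumberField IsDedekindDomain

namespace Literature.NumberTheory.Automorphic.IdeleClassGroup

open GaloisRepresentations

variable {L : Type} [Field L] [NumberField L] [IsCMField L]

/-! ## §1 `μᶜ = μ⁻¹` for a conjugate self-dual character -/

/-- **`μᶜ = μ⁻¹` as Hecke characters** for a conjugate self-dual `μ` ([Liu2021] Def. 4.1: `μ[y ȳ] = 1`, i.e.
`μ[c • y] = μ[y]⁻¹`). [cite: Liu2021, Def. 4.1] -/
theorem toHeckeCharacter_galConj_complexConj {ψ : IdeleClassGroup L →ₜ* Circle} (h : IsConjugateSelfDual L ψ) :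
    toHeckeCharacter L (galConj (IsCMField.complexConj L) ψ) = (toHeckeCharacter L ψ)⁻¹ :=
  HeckeCharacter.ext fun x => Units.ext (by
    rw [coe_toHeckeCharacter_apply, HeckeCharacter.inv_apply, Units.val_inv_eq_inv_val, coe_toHeckeCharacter_apply,
      (isConjugateSelfDual_iff_galConj_eq_inv ψ).1 h, Circle.coe_inv])

/-- the conjugate-symplectic case ([Liu2021] Remark 4.2: conjugate symplectic ⇒ conjugate self-dual). [cite: Liu2021, Remark 4.2] -/
theorem IsConjugateSymplectic.toHeckeCharacter_galConj_complexConj {ψ : IdeleClassGroup L →ₜ* Circle}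
    (h : IsConjugateSymplectic L ψ) :
    toHeckeCharacter L (IdeleClassGroup.galConj (IsCMField.complexConj L) ψ) = (toHeckeCharacter L ψ)⁻¹ :=
  IdeleClassGroup.toHeckeCharacter_galConj_complexConj h.isConjugateSelfDual

/-- **the local components: `(μᶜ)_w = (μ_w)⁻¹`** at every finite place `w` of `L` (as characters of `L_wˣ`).
[cite: Liu2021, Def. 4.1; TateThesis1967, §4.3] -/
theorem localComponent_toHeckeCharacter_galConj_complexConj {ψ : IdeleClassGroup L →ₜ* Circle}
    (h : IsConjugateSelfDual L ψ) (w : HeightOneSpectrum (𝓞 L)) :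
    (toHeckeCharacter L (galConj (IsCMField.complexConj L) ψ)).localComponent w =
      ((toHeckeCharacter L ψ).localComponent w)⁻¹ := by
  rw [toHeckeCharacter_galConj_complexConj h]
  rfl

/-- pointwise: `(μᶜ)_w(u) = μ_w(u)⁻¹`. [cite: Liu2021, Def. 4.1; TateThesis1967, §4.3] -/
theorem localComponent_toHeckeCharacter_galConj_complexConj_apply {ψ : IdeleClassGroup L →ₜ* Circle}
    (h : IsConjugateSelfDual L ψ) (w : HeightOneSpectrum (𝓞 L)) (u : (w.adicCompletion L)ˣ) :
    (toHeckeCharacter L (galConj (IsCMField.complexConj L) ψ)).localComponent w u =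
      ((toHeckeCharacter L ψ).localComponent w u)⁻¹ := by
  rw [localComponent_toHeckeCharacter_galConj_complexConj h w, MonoidHom.inv_apply]

/-- the conjugate-symplectic case of the local identity. [cite: Liu2021, Remark 4.2] -/
theorem IsConjugateSymplectic.localComponent_toHeckeCharacter_galConj_complexConj
    {ψ : IdeleClassGroup L →ₜ* Circle} (h : IsConjugateSymplectic L ψ) (w : HeightOneSpectrum (𝓞 L)) :
    (toHeckeCharacter L (IdeleClassGroup.galConj (IsCMField.complexConj L) ψ)).localComponent w =
      ((toHeckeCharacter L ψ).localComponent w)⁻¹ :=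
  IdeleClassGroup.localComponent_toHeckeCharacter_galConj_complexConj h.isConjugateSelfDual w

/-- **`μᶜ(ϖ_w) = μ(ϖ_w)⁻¹`** at every finite place (values at the tree's uniformiser `ϖ_w`).
[cite: Liu2021, Def. 4.1] -/
theorem valueAtUniformizer_toHeckeCharacter_galConj_complexConj {ψ : IdeleClassGroup L →ₜ* Circle}
    (h : IsConjugateSelfDual L ψ) (w : HeightOneSpectrum (𝓞 L)) :
    (toHeckeCharacter L (galConj (IsCMField.complexConj L) ψ)).valueAtUniformizer w =
      ((toHeckeCharacter L ψ).valueAtUniformizer w)⁻¹ := by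
  rw [toHeckeCharacter_galConj_complexConj h, HeckeCharacter.valueAtUniformizer_inv']

/-! ## §2 `μ(ϖ_{c•w}) = μ(ϖ_w)⁻¹` -/

/-- **`μ(ϖ_{c•w}) = μ(ϖ_w)⁻¹`** for a conjugate self-dual `μ` unramified at `c • w`: `μᶜ(ϖ_w) = μ(ϖ_{c•w})`
(transport of uniformisers, `valueAtUniformizer_galConj_of_isUnramifiedAt`) and `μᶜ = μ⁻¹`.
[cite: Liu2021, Def. 4.1] -/
theorem valueAtUniformizer_toHeckeCharacter_complexConj_smul {ψ : IdeleClassGroup L →ₜ* Circle}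
    (h : IsConjugateSelfDual L ψ) (w : HeightOneSpectrum (𝓞 L))
    (hunr : (toHeckeCharacter L ψ).IsUnramifiedAt (IsCMField.complexConj L • w)) :
    (toHeckeCharacter L ψ).valueAtUniformizer (IsCMField.complexConj L • w) =
      ((toHeckeCharacter L ψ).valueAtUniformizer w)⁻¹ := by
  rw [← HeckeCharacter.valueAtUniformizer_galConj_of_isUnramifiedAt (IsCMField.complexConj L) _ w hunr,
    ← toHeckeCharacter_galConj, valueAtUniformizer_toHeckeCharacter_galConj_complexConj h]

/-- the conjugate-symplectic case. [cite: Liu2021, Remark 4.2] -/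
theorem IsConjugateSymplectic.valueAtUniformizer_toHeckeCharacter_complexConj_smul {ψ : IdeleClassGroup L →ₜ* Circle}
    (h : IsConjugateSymplectic L ψ) (w : HeightOneSpectrum (𝓞 L))
    (hunr : (toHeckeCharacter L ψ).IsUnramifiedAt (IsCMField.complexConj L • w)) :
    (toHeckeCharacter L ψ).valueAtUniformizer (IsCMField.complexConj L • w) =
      ((toHeckeCharacter L ψ).valueAtUniformizer w)⁻¹ :=
  IdeleClassGroup.valueAtUniformizer_toHeckeCharacter_complexConj_smul h.isConjugateSelfDual w hunr

/-! ## §3 The algebraic twist `μ^{alg}`: `μ^{alg}(ϖ_{c•w}) μ^{alg}(ϖ_w) = q_w` -/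

omit [IsCMField L] in
/-- the value of a unitary character at a uniformiser is non-zero. [cite: Liu2021, §4.1 (l. 1922)] -/
theorem valueAtUniformizer_toHeckeCharacter_ne_zero (ψ : IdeleClassGroup L →ₜ* Circle) (w : HeightOneSpectrum (𝓞 L)) :
    (toHeckeCharacter L ψ).valueAtUniformizer w ≠ 0 :=
  Units.ne_zero _

/-- **`μ^{alg}(ϖ_{c•w}) · μ^{alg}(ϖ_w) = q_w`** for a conjugate self-dual `μ` unramified at `c • w`
(`μ^{alg}(ϖ_v) = μ(ϖ_v) √q_v`, `q_{c•w} = q_w`, `μ(ϖ_{c•w}) μ(ϖ_w) = 1`). [cite: Liu2021, §4.1 (l. 1922), Def. 4.1] -/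
theorem valueAtUniformizer_muAlg_complexConj_smul_mul {ψ : IdeleClassGroup L →ₜ* Circle}
    (h : IsConjugateSelfDual L ψ) (w : HeightOneSpectrum (𝓞 L))
    (hunr : (toHeckeCharacter L ψ).IsUnramifiedAt (IsCMField.complexConj L • w)) :
    (muAlg L ψ).valueAtUniformizer (IsCMField.complexConj L • w) * (muAlg L ψ).valueAtUniformizer w =
      ((Ideal.absNorm w.asIdeal : ℕ) : ℂ) := by
  have ha := valueAtUniformizer_toHeckeCharacter_ne_zero ψ w
  have hs : ((Real.sqrt ((Ideal.absNorm w.asIdeal : ℕ) : ℝ) : ℂ)) * ((Real.sqrt ((Ideal.absNorm w.asIdeal : ℕ) : ℝ) : ℂ)) =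
      ((Ideal.absNorm w.asIdeal : ℕ) : ℂ) := by
    rw [← Complex.ofReal_mul, Real.mul_self_sqrt (Nat.cast_nonneg _), Complex.ofReal_natCast]
  rw [valueAtUniformizer_muAlg, valueAtUniformizer_muAlg, valueAtUniformizer_toHeckeCharacter_complexConj_smul h w hunr,
    HeightOneSpectrum.absNorm_algEquiv_smul, ← hs]
  field_simp

/-- **`μ^{alg}(ϖ_{c•w}) = q_w / μ^{alg}(ϖ_w)`**. [cite: Liu2021, §4.1 (l. 1922), Def. 4.1] -/
theorem valueAtUniformizer_muAlg_complexConj_smul {ψ : IdeleClassGroup L →ₜ* Circle}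
    (h : IsConjugateSelfDual L ψ) (w : HeightOneSpectrum (𝓞 L))
    (hunr : (toHeckeCharacter L ψ).IsUnramifiedAt (IsCMField.complexConj L • w)) :
    (muAlg L ψ).valueAtUniformizer (IsCMField.complexConj L • w) =
      ((Ideal.absNorm w.asIdeal : ℕ) : ℂ) / (muAlg L ψ).valueAtUniformizer w := by
  have hne : (muAlg L ψ).valueAtUniformizer w ≠ 0 := Units.ne_zero _
  rw [eq_div_iff hne, valueAtUniformizer_muAlg_complexConj_smul_mul h w hunr]

/-- the conjugate-symplectic case. [cite: Liu2021, Remark 4.2, §4.1 (l. 1922)] -/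
theorem IsConjugateSymplectic.valueAtUniformizer_muAlg_complexConj_smul {ψ : IdeleClassGroup L →ₜ* Circle}
    (h : IsConjugateSymplectic L ψ) (w : HeightOneSpectrum (𝓞 L))
    (hunr : (toHeckeCharacter L ψ).IsUnramifiedAt (IsCMField.complexConj L • w)) :
    (muAlg L ψ).valueAtUniformizer (IsCMField.complexConj L • w) =
      ((Ideal.absNorm w.asIdeal : ℕ) : ℂ) / (muAlg L ψ).valueAtUniformizer w :=
  IdeleClassGroup.valueAtUniformizer_muAlg_complexConj_smul h.isConjugateSelfDual w hunr

/-- **`(μ^{alg})ᶜ(ϖ_w) = μ^{alg}(ϖ_{c•w})`** when `μ^{alg}` is unramified at `c • w` (the tree's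
`valueAtUniformizer_galConj_of_isUnramifiedAt`, restated for `μ₂ := (μ^{alg})ᶜ · χ̌` of the d6 card).
[cite: Liu2021, Remark 4.4 (ll. 1930–1933)] -/
theorem valueAtUniformizer_galConj_muAlg (ψ : IdeleClassGroup L →ₜ* Circle) (w : HeightOneSpectrum (𝓞 L))
    (hunr : (muAlg L ψ).IsUnramifiedAt (IsCMField.complexConj L • w)) :
    (HeckeCharacter.galConj (IsCMField.complexConj L) (muAlg L ψ)).valueAtUniformizer w =
      (muAlg L ψ).valueAtUniformizer (IsCMField.complexConj L • w) :=
  HeckeCharacter.valueAtUniformizer_galConj_of_isUnramifiedAt _ _ w hunr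

/-- **`(μ^{alg})ᶜ(ϖ_w) · μ^{alg}(ϖ_w) = q_w`** for a conjugate self-dual `μ` unramified at `c • w`.
[cite: Liu2021, §4.1 (l. 1922), Remark 4.4] -/
theorem valueAtUniformizer_galConj_muAlg_mul {ψ : IdeleClassGroup L →ₜ* Circle} (h : IsConjugateSelfDual L ψ)
    (w : HeightOneSpectrum (𝓞 L)) (hunr : (toHeckeCharacter L ψ).IsUnramifiedAt (IsCMField.complexConj L • w)) :
    (HeckeCharacter.galConj (IsCMField.complexConj L) (muAlg L ψ)).valueAtUniformizer w * (muAlg L ψ).valueAtUniformizer w =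
      ((Ideal.absNorm w.asIdeal : ℕ) : ℂ) := by
  rw [valueAtUniformizer_galConj_muAlg ψ w ((isUnramifiedAt_muAlg_iff L ψ _).2 hunr),
    valueAtUniformizer_muAlg_complexConj_smul_mul h w hunr]

end Literature.NumberTheory.Automorphic.IdeleClassGroup

end
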